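import Summits.ResolutionOfSingularities.ResolutionOfSingularities.Theorems.HomologicalConductorNoZenoRNonIsoLocus
import Literature.AlgebraicGeometry.Resolution.BlowupsExistence
import Literature.AlgebraicGeometry.Resolution.BlowupsProperProofs
import Literature.AlgebraicGeometry.Resolution.BlowupsIntegral
import Literature.AlgebraicGeometry.Resolution.RegularBlowup
import Literature.AlgebraicGeometry.Resolution.PointCentrePermissible
import Literature.AlgebraicGeometry.Resolution.EmbeddedCurvePointBlowups
import HarnessLib

/-!
# Crux `NoZenoR` (stmt-ResolutionOfSingularities-19943) — the blown-up stage is again a desingularization, and the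
# ONE-STEP DESCENT `hstep` of the first-kind clause (F) DISCHARGED

Route `ResolutionOfSingularities/HomologicalConductor` (cell decomp-res, hand leafhand-res-homologicalconduct-18 g1).
OURS: AI-written proof over tree theorems, weaker than expert review; nothing here is a statement of the manuscript
under review (Hironaka 2017).  SUPPORT level, counted 0.  Def-free, no new named facts.

* `isResolution_blowup_point_comp` — for a desingularization `ρ : Y → Spec S` of a Noetherian local domain and a
  blowing up `b : Y₁ → Y` of a closed point `y` with `dim 𝒪_{Y,y} = 2` (reduced centre `𝓘_{y}`), `b ≫ ρ` is again a
  desingularization: `b` is proper (`IsBlowup.isProper`), birational (`IsBlowup.isBirational'`, the centre is a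
  non-zero ideal) and `Y₁` is regular (blowing up a regular scheme along the regular centre `Spec κ(y)`,
  `IsBlowup.isRegular_of_isRegular_subscheme` with `isRegular_subscheme_vanishingIdeal_singleton`);
* **`step`** — the one-step descent of Zariski's factorisation (Stacks 0C5R), i.e. the binder `hstep` of hand 16 g3's
  `…ExcCount.FirstKind.firstKindClause_of_step`, DISCHARGED for `S` a two-dimensional Noetherian local NORMAL domain:
  a non-isomorphic `S`-morphism `h : X → Y` between desingularizations factors as `h = h₁ ≫ b` through a blowing up
  `b : Y₁ → Y` of a closed point `y` with `dim 𝒪_{Y,y} = 2`, and `b ≫ ρ` is a desingularization (non-iso locus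
  `…FirstKind.exists_fac_blowup_point_of_not_isIso` = purity + ZMT + FactorStep′; existence of blow-ups
  `exists_isBlowup`; this file's first theorem).

No crux or summit statement is proved here.
-/

noncomputable section

-- single-problem summit: the doubled namespace component `ResolutionOfSingularities` is forced
set_option linter.dupNamespace false

open CategoryTheory AlgebraicGeometry TopologicalSpace Topology IsLocalRing
open Literature.AlgebraicGeometry.Resolution
open Scheme.IdealSheafData

universe u

namespace Summit.ResolutionOfSingularities.ResolutionOfSingularities.Theorems.NoZeno.FirstKind

variable {S : Type u} [CommRing S] [IsNoetherianRing S] [IsLocalRing S] [IsDomain S]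
  {X Y : Scheme.{u}} {ρ : Y ⟶ Spec (.of S)} {h : X ⟶ Y}

omit [IsLocalRing S] in
/-- **The point blow-up of a desingularization is a desingularization.**  For `ρ : Y → Spec S` a desingularization of
a Noetherian domain, `y ∈ Y` a closed point with `dim 𝒪_{Y,y} = 2` and `b : Y₁ → Y` a blowing up of `Y` along the
reduced ideal of `y`, the composite `b ≫ ρ` is proper, birational, with regular source.
[cite: Liu2002, Thm. 8.1.19 (a)]; [cite: StacksProject, Tag 02ND] -/
theorem isResolution_blowup_point_comp (hρ : IsResolution ρ) {y : Y} (hy : IsClosed ({y} : Set Y))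
    (hy2 : ringKrullDim (Y.presheaf.stalk y) = 2) {Y₁ : Scheme.{u}} {b : Y₁ ⟶ Y}
    (hb : IsBlowup b (vanishingIdeal ⟨{y}, hy⟩)) : IsResolution (b ≫ ρ) := by
  haveI : IsIntegral Y := hρ.isIntegral_source
  haveI : IsProper ρ := hρ.isProper
  haveI : IsLocallyNoetherian Y := LocallyOfFiniteType.isLocallyNoetherian ρ
  -- `{y}` is not all of `Y`: the generic point has a zero-dimensional local ring
  have hne : ({y} : Set Y) ≠ Set.univ := by
    intro huniv
    have hgen : y = genericPoint Y := by
      have : genericPoint Y ∈ ({y} : Set Y) := huniv ▸ Set.mem_univ _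
      exact this.symm
    subst hgen
    have h0 : ringKrullDim Y.functionField = 0 :=
      ringKrullDim_eq_zero_of_isField (Field.toIsField Y.functionField)
    have h20 : (2 : WithBot ℕ∞) = 0 := hy2.symm.trans h0
    exact absurd h20 (by decide)
  have hJ : vanishingIdeal (⟨{y}, hy⟩ : Closeds Y) ≠ ⊥ := vanishingIdeal_singleton_ne_bot hy hne
  haveI : IsProper b := hb.isProper
  refine ⟨inferInstance, (hb.isBirational' hJ).comp hρ.isBirational, ?_⟩
  exact IsBlowup.isRegular_of_isRegular_subscheme hρ.isRegular (isRegular_subscheme_vanishingIdeal_singleton hy) hb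

/-- **The one-step descent of Zariski's factorisation (`hstep` of `firstKindClause_of_step`, DISCHARGED).**  `S` a
two-dimensional Noetherian local normal domain, `ρ : Y → Spec S` and `h ≫ ρ : X → Spec S` desingularizations, `h` not
an isomorphism: there are a closed point `y ∈ Y` with `dim 𝒪_{Y,y} = 2`, a blowing up `b : Y₁ → Y` of `Y` at `y`, and a
factorisation `h = h₁ ≫ b`, with `b ≫ ρ` again a desingularization.
[cite: StacksProject, Tag 0C5R]; [cite: Lipman1969, Corollary (27.3), proof (p. 277)] -/
theorem step [IsIntegrallyClosed S] (h2 : ringKrullDim S = 2) (hπ : IsResolution (h ≫ ρ))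
    (hρ : IsResolution ρ) (hh : ¬ IsIso h) :
    ∃ (y : Y) (hy : IsClosed ({y} : Set Y)), ringKrullDim (Y.presheaf.stalk y) = 2 ∧
      ∃ (Y₁ : Scheme.{u}) (b : Y₁ ⟶ Y) (h₁ : X ⟶ Y₁),
        IsBlowup b (vanishingIdeal ⟨{y}, hy⟩) ∧ h₁ ≫ b = h ∧ IsResolution (b ≫ ρ) := by
  obtain ⟨y, hy, -, hy2, -, hfac⟩ := exists_fac_blowup_point_of_not_isIso h2 hπ hρ hh
  obtain ⟨Y₁, b, hb⟩ := exists_isBlowup Y (vanishingIdeal ⟨{y}, hy⟩)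
  obtain ⟨h₁, hh₁⟩ := hfac hb
  exact ⟨y, hy, hy2, Y₁, b, h₁, hb, hh₁, isResolution_blowup_point_comp hρ hy hy2 hb⟩

/-- **`π`-form of the step** (the literal shape of the binder `hstep` of
`…ExcCount.FirstKind.firstKindClause_of_step`, for every universe): for a desingularization `π : X → Spec S` of a
two-dimensional Noetherian local normal domain, every non-isomorphic `S`-morphism `h : X → Y` to a desingularization
`g : Y → Spec S` descends one point blow-up. [cite: StacksProject, Tag 0C5R] -/
theorem step_of_fac [IsIntegrallyClosed S] (h2 : ringKrullDim S = 2) {π : X ⟶ Spec (.of S)}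
    (hπ : IsResolution π) :
    ∀ (Y : Scheme.{u}) (g : Y ⟶ Spec (.of S)) (h : X ⟶ Y), IsResolution g → h ≫ g = π → ¬ IsIso h →
      ∃ (y : Y) (hy : IsClosed ({y} : Set Y)), ringKrullDim (Y.presheaf.stalk y) = 2 ∧
        ∃ (Y₁ : Scheme.{u}) (b : Y₁ ⟶ Y) (h₁ : X ⟶ Y₁),
          IsBlowup b (vanishingIdeal ⟨{y}, hy⟩) ∧ h₁ ≫ b = h ∧ IsResolution (b ≫ g) := by
  intro Y g h hg hfac hh
  subst hfac
  exact step h2 hπ hg hh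

end Summit.ResolutionOfSingularities.ResolutionOfSingularities.Theorems.NoZeno.FirstKind

end
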